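import Literature.AlgebraicGeometry.Frobenioids.Thm49FunctorialBaseIsos
import Literature.AlgebraicGeometry.Frobenioids.Thm49FunctorialPullbacksWeak
import HarnessLib

/-!
# [FrdI] Theorem 4.9, rows T49-L03/L04 packaged (functoriality of `Ψ^Φ` on `C₁^bs-iso`, hence on `C₁`) in the
# WEAK setting

Mochizuki, *The geometry of Frobenioids I: the general theory*, Kyushu J. Math. **62** (2008)
293–400, §4, proof of Theorem 4.9, p. 89 ll. 25–36 ("… hence determines an isomorphism of monoids
`Φ₁(A₁) ⥲ Φ₂(A₂)` which is functorial in `A₁` [regarded as an object of `C₁^bs-iso`] … with respect to pull-back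
morphisms") [cite: MochizukiFrdI2008, Thm. 4.9 p.89].

PROOF-ONLY file (cell abc-iut, layer L1, seat abc-iut-L1-t14; row «C411iii/iv-WEAK» = the [FrdI] Thm. 4.9 /
Cor. 4.11 (iii)(iv) chain over `IsPerfFactorialWeak`, block (T2)). WEAK-HYPOTHESIS TWINS of the four
`T42.Setting`-typed packagings of `Thm49FunctorialBaseIsos.lean` (seat abc-iut-w4-d099), now over
`FrdI.T42.SettingWeak` (`Thm42SubWeak.lean`; "`Φ_i` perf-factorial" weakened to "`Φ_i` weakly perf-factorial",
Def. 2.4 (i) (a)(b)(c) + (d_ord) + (d_res); cell finding F-L2d2-1): `FrdI.T49.functorialBaseIsos_weak`,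
`natural_of_div_clause_weak`, `sufficesRightEqLeft_conclusion_of_div_clause_weak`,
`sufficesRightEqLeft_conclusion_of_forall_exists_weak`. The hypothesis-free lemmas of the strong file
(`PreFrobenioid.pull_natural_of_isBaseIso_of_div_clause`, `pull_natural_of_div_clause`, …) are consumed BY NAME;
only the fields `isFrobenioid_i`, `perfect₁`, `preStep_map`, `frobeniusType_map`, `degFr_map`, `pullback_map`
of the setting enter, so the proofs are verbatim. No new definitions; nothing of the paper restated or
strengthened; nothing here is specific to the abc programme and no side is taken on [IUTchIII] Cor. 3.12.
-/

namespace Literature.AlgebraicGeometry.Frobenioids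

open CategoryTheory Opposite

universe w v v' u u'

/-! ### In the binders of `FrdI.T49.SufficesRightEqLeft` -/

namespace FrdI.T49

variable {D₁ : Type u} [Category.{v} D₁] {Φ₁ : D₁ᵒᵖ ⥤ CommMonCat.{w}} {C₁ : Type u'}
  [Category.{v'} C₁] {D₂ : Type u} [Category.{v} D₂] {Φ₂ : D₂ᵒᵖ ⥤ CommMonCat.{w}} {C₂ : Type u'}
  [Category.{v'} C₂] {F₁ : C₁ ⥤ ElemFrobenioid Φ₁} {F₂ : C₂ ⥤ ElemFrobenioid Φ₂} {Ψ : C₁ ≌ C₂}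

/-- (WEAK setting: `T42.SettingWeak`, weakly perf-factorial `Φ_i`.) **T49-L03, functoriality clause, as consumed by `SufficesRightEqLeft`.** In a
`T42.SettingWeak F₁ F₂ Ψ`, every family of monoid isomorphisms `m_A : Φ₁(A) ≃* Φ₂(Ψ A)` with the
pre-step clause `m_A(Div φ) = Div(Ψ φ)` is functorial in `A ∈ Ob(C₁^bs-iso)`.
[cite: MochizukiFrdI2008, Thm. 4.9 p.89] -/
theorem functorialBaseIsos_weak (S : T42.SettingWeak F₁ F₂ Ψ)
    (m : ∀ A : C₁, Φ₁.obj (op (PreFrobenioid.baseObj F₁ A)) ≃*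
      Φ₂.obj (op (PreFrobenioid.baseObj F₂ (Ψ.functor.obj A))))
    (hm : ∀ ⦃A B : C₁⦄ (φ : A ⟶ B), PreFrobenioid.IsPreStep F₁ φ →
      m A (PreFrobenioid.Div F₁ φ) = PreFrobenioid.Div F₂ (Ψ.functor.map φ))
    ⦃A B : C₁⦄ (φ : A ⟶ B) (hφ : PreFrobenioid.IsBaseIso F₁ φ)
    (z : Φ₁.obj (op (PreFrobenioid.baseObj F₁ B))) :
    m A (pull Φ₁ (PreFrobenioid.Base F₁ φ) z) =
      pull Φ₂ (PreFrobenioid.Base F₂ (Ψ.functor.map φ)) (m B z) :=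
  PreFrobenioid.pull_natural_of_isBaseIso_of_div_clause S.isFrobenioid₁ S.isFrobenioid₂ S.perfect₁
    Ψ.functor (fun _ _ φ h => (S.preStep_map φ h).1) S.frobeniusType_map S.degFr_map
    (fun A => (m A).toMonoidHom) hm φ hφ z

/-- (WEAK setting: `T42.SettingWeak`, weakly perf-factorial `Φ_i`.) **Functorial on `C₁`** (rows T49-L03 + T49-L04): in a `T42.SettingWeak F₁ F₂ Ψ`, every family of
monoid isomorphisms `m_A : Φ₁(A) ≃* Φ₂(Ψ A)` with the pre-step clause is natural along every
morphism of `C₁` — the second clause of the conclusion of `SufficesRightEqLeft`.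
[cite: MochizukiFrdI2008, Thm. 4.9 p.89] -/
theorem natural_of_div_clause_weak (S : T42.SettingWeak F₁ F₂ Ψ)
    (m : ∀ A : C₁, Φ₁.obj (op (PreFrobenioid.baseObj F₁ A)) ≃*
      Φ₂.obj (op (PreFrobenioid.baseObj F₂ (Ψ.functor.obj A))))
    (hm : ∀ ⦃A B : C₁⦄ (φ : A ⟶ B), PreFrobenioid.IsPreStep F₁ φ →
      m A (PreFrobenioid.Div F₁ φ) = PreFrobenioid.Div F₂ (Ψ.functor.map φ))
    ⦃A B : C₁⦄ (φ : A ⟶ B) (z : Φ₁.obj (op (PreFrobenioid.baseObj F₁ B))) :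
    m A (pull Φ₁ (PreFrobenioid.Base F₁ φ) z) =
      pull Φ₂ (PreFrobenioid.Base F₂ (Ψ.functor.map φ)) (m B z) :=
  natural_of_baseIso_natural_weak S m hm (functorialBaseIsos_weak S m hm) φ z

/-- (WEAK setting: `T42.SettingWeak`, weakly perf-factorial `Φ_i`.) **Reduction of `SufficesRightEqLeft`'s conclusion to an objectwise statement.** In a
`T42.SettingWeak F₁ F₂ Ψ`, a family of monoid isomorphisms `m_A : Φ₁(A) ≃* Φ₂(Ψ A)` (one for each
object, no compatibility between different objects assumed) satisfying the pre-step clause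
ALREADY witnesses the full conclusion `∃ m, (pre-step clause) ∧ (functorial on C₁)` of
`FrdI.T49.SufficesRightEqLeft`. [cite: MochizukiFrdI2008, Thm. 4.9 p.89] -/
theorem sufficesRightEqLeft_conclusion_of_div_clause_weak (S : T42.SettingWeak F₁ F₂ Ψ)
    (m : ∀ A : C₁, Φ₁.obj (op (PreFrobenioid.baseObj F₁ A)) ≃*
      Φ₂.obj (op (PreFrobenioid.baseObj F₂ (Ψ.functor.obj A))))
    (hm : ∀ ⦃A B : C₁⦄ (φ : A ⟶ B), PreFrobenioid.IsPreStep F₁ φ →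
      m A (PreFrobenioid.Div F₁ φ) = PreFrobenioid.Div F₂ (Ψ.functor.map φ)) :
    ∃ m : ∀ A : C₁, Φ₁.obj (op (PreFrobenioid.baseObj F₁ A)) ≃*
        Φ₂.obj (op (PreFrobenioid.baseObj F₂ (Ψ.functor.obj A))),
      (∀ ⦃A B : C₁⦄ (φ : A ⟶ B), PreFrobenioid.IsPreStep F₁ φ →
          m A (PreFrobenioid.Div F₁ φ) = PreFrobenioid.Div F₂ (Ψ.functor.map φ)) ∧
      ∀ ⦃A B : C₁⦄ (φ : A ⟶ B) (x : Φ₁.obj (op (PreFrobenioid.baseObj F₁ B))),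
        m A (pull Φ₁ (PreFrobenioid.Base F₁ φ) x) =
          pull Φ₂ (PreFrobenioid.Base F₂ (Ψ.functor.map φ)) (m B x) :=
  ⟨m, hm, natural_of_div_clause_weak S m hm⟩

/-- (WEAK setting: `T42.SettingWeak`, weakly perf-factorial `Φ_i`.) **Objectwise existence with the pre-step clause suffices** (pointwise-`∃` form: the family may be
chosen by the axiom of choice, since no compatibility between objects is required).
[cite: MochizukiFrdI2008, Thm. 4.9 p.89] -/
theorem sufficesRightEqLeft_conclusion_of_forall_exists_weak (S : T42.SettingWeak F₁ F₂ Ψ)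
    (h : ∀ A : C₁, ∃ mA : Φ₁.obj (op (PreFrobenioid.baseObj F₁ A)) ≃*
        Φ₂.obj (op (PreFrobenioid.baseObj F₂ (Ψ.functor.obj A))),
      ∀ ⦃B : C₁⦄ (φ : A ⟶ B), PreFrobenioid.IsPreStep F₁ φ →
        mA (PreFrobenioid.Div F₁ φ) = PreFrobenioid.Div F₂ (Ψ.functor.map φ)) :
    ∃ m : ∀ A : C₁, Φ₁.obj (op (PreFrobenioid.baseObj F₁ A)) ≃*
        Φ₂.obj (op (PreFrobenioid.baseObj F₂ (Ψ.functor.obj A))),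
      (∀ ⦃A B : C₁⦄ (φ : A ⟶ B), PreFrobenioid.IsPreStep F₁ φ →
          m A (PreFrobenioid.Div F₁ φ) = PreFrobenioid.Div F₂ (Ψ.functor.map φ)) ∧
      ∀ ⦃A B : C₁⦄ (φ : A ⟶ B) (x : Φ₁.obj (op (PreFrobenioid.baseObj F₁ B))),
        m A (pull Φ₁ (PreFrobenioid.Base F₁ φ) x) =
          pull Φ₂ (PreFrobenioid.Base F₂ (Ψ.functor.map φ)) (m B x) := by
  choose m hm using h
  exact sufficesRightEqLeft_conclusion_of_div_clause_weak S m (fun A _ φ hφ => hm A φ hφ)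

end FrdI.T49

end Literature.AlgebraicGeometry.Frobenioids
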